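import Summits.QuantumFields.YangMills.Theorems.FluctuationComparisonRegPrIntLS2BetaCriticalOrbitUnique
import HarnessLib

/-!
# S2β · ONE TOKEN FOR THE GENERIC DATUM — IRR(V) ⟹ CENTRAL STABILISER, and [Balaban1985Variational] Prop. 7 clause 1 KEYED ON IRR(V)

Cell `ym3-torus` (rung R3 = SU(2) YM₃ on T³ — NOT d = 4, NOT infinite volume, NOT a mass gap, NOT Clay).  Width seat `ym3-torus-px17` (gen 15), pen 6; FREE px helper of
`stmt-QuantumFields-20520` (`--supports … --as helper`, count-neutral); DEFINITION-FREE (0 `def`∕`instance`∕`notation`∕`sorry`, default heartbeats).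

WHY.  After ✓p798004 (pen 4: Prop. 7 clause 1 at every datum with CENTRAL STABILISER, `L ≥ 5`) and px21 g19's (T7a∕T7b) (POS∘∕TUBE♭ at print's regular minimiser over an
IRREDUCIBLE datum), the per-datum chain at a generic datum carried TWO tokens for one stratum: the group-level «`s • V = V ⇒ s ≡ 1 ∨ s ≡ −1`» (pen 4 ⇒ ✓p798217 px8 ISOL∘)
and the linear «IRR(V): every matrix field intertwining `V` (`s(b₋)·V_b = V_b·s(b₊)`) is a GLOBAL scalar» ((T7b)).  The direction IRR ⇒ central stabiliser is `2 × 2` algebra with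
no lattice connectivity: `s • V = V` IS the intertwiner relation; IRR gives a global `c` with `↑(s x) = c•𝟙`; `det = 1` at one site forces `c² = 1`.  So ONE token — IRR(V), with
(T7b)'s binder byte for byte — runs the whole per-datum chain.

WHAT.
* §1 ★`centralStab_of_irr` — IRR(V) ⟹ `∀ s, s • V = V → s = (fun _ => 1) ∨ s = (fun _ => −1)`.
* §2 ★★`atMostOneCriticalOrbit_of_irr_five` — [Balaban1985Variational] PROP. 7 CLAUSE 1 AT EVERY IRREDUCIBLE DATUM, `L ≥ 5`, `e ≤ e₈(L)`: ✓pen 4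
  `atMostOneCriticalOrbit_of_centralStab_five` ∘ §1 (px8's ✓p798217 `h1` socket at the (T7b) token).
* §3 ★`critical_residualRelated_of_irr_five` — over an irreducible datum two R2-critical (6)-regular configurations are related by a fine gauge transformation
  whose (1.29)-descent is IDENTICALLY `1` (✓pen 4 `critical_gaugeRelated_five` gives `u` with `(u↓) • V = V`; §1 makes `u↓ ≡ ±1`; replace `u` by `(−1)·u` if needed —
  same action, descent flipped by ✓`descTransf_const_mul`).
NOT HERE (honest).  The converse «central stabiliser ⇒ IRR» needs lattice connectivity (a non-scalar traceless self-adjoint intertwiner exponentiates to an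
`SU(2)`-valued stabiliser; «globally scalar» is a connectedness statement) — px21's (T7d) if still wanted; with §1 no consumer needs it.  Reducible curved data, TUBE-REG∘,
GAP♯∘, EXW∘, S2β, 20520, `YM3TorusSU2` NOT proved; the Yang–Mills mass gap is NOT proved.
References: T. Bałaban, CMP **102** (1985) 277–309 [Balaban1985Variational] (Prop. 7 p.299, group (4) p.278); CMP **99** (1985) 75–102 [Balaban1985RegularSpaces] ((1.29) p.81);
CMP **98** (1985) 17–51 [Balaban1985Averaging] ((8) p.19).
-/

set_option autoImplicit false
noncomputable section

open scoped BigOperators Matrix.Norms.L2Operator Matrix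

namespace Summit.QuantumFields.YangMills.Theorems.FluctuationComparisonRegPrIntLS2BetaCentralStabOfIrr

open Literature.MathematicalPhysics.QuantumFieldTheory.Balaban1983to89
open Literature.MathematicalPhysics.QuantumFieldTheory.Balaban1983to89.T3ContinuumYM3Torus
open Literature.MathematicalPhysics.QuantumFieldTheory.Balaban1983to89.T3PrintedRegularMinimiser
open Literature.MathematicalPhysics.QuantumFieldTheory.Balaban1983to89.T3PrintedRegularOrbits (descTransf)
open Literature.MathematicalPhysics.QuantumFieldTheory.Balaban1983to89.T3Thm1Carrier (varProblem3)
open Literature.MathematicalPhysics.QuantumFieldTheory.Balaban1983to89.T3Thm1CarrierNative (IsCritR2)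
open Summit.QuantumFields.YangMills.Theorems.BrascampLiebVacuumSC.DimensionGapSU2 (neg_one_mem)
open Summit.QuantumFields.YangMills.Theorems.FluctuationComparisonRegPrIntLS2BetaCriticalOrbitUnique
  (atMostOneCriticalOrbit_of_centralStab_five critical_gaugeRelated_five descTransf_const_mul gaugeAct_negOne_mul negOne_mul_negOne)

/-! ## §1 IRR(V) ⟹ central stabiliser -/

section Irr

variable (F : T3Family) {n : ℕ}

/-- ★ **IRR(V) ⟹ CENTRAL STABILISER.**  If every matrix field intertwining the datum `V` (`s(b₋)·V_b = V_b·s(b₊)` on every bond) is a global scalar — (T7b)'s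
IRR(V), byte for byte — then every `SU(2)`-valued gauge transformation fixing `V` is identically `1` or identically `−1`: `s • V = V` is the intertwiner relation,
so `↑(s x) = c•𝟙` for one `c`, and `det ↑(s x₀) = 1` gives `c² = 1`. [cite: Balaban1985Variational, (4) p.278; Balaban1985Averaging, (8) p.19] -/
theorem centralStab_of_irr (V : GaugeField (F.P n) 0 (Matrix.specialUnitaryGroup (Fin 2) ℂ))
    (hirr : ∀ s : Site (F.P n) 0 → Matrix (Fin 2) (Fin 2) ℂ,
      (∀ b : PBond (F.P n) 0, s b.src * (V b : Matrix (Fin 2) (Fin 2) ℂ) = (V b : Matrix (Fin 2) (Fin 2) ℂ) * s b.tgt) →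
        ∃ c : ℂ, ∀ x, s x = c • (1 : Matrix (Fin 2) (Fin 2) ℂ)) :
    ∀ s : GaugeTransf (F.P n) 0 (Matrix.specialUnitaryGroup (Fin 2) ℂ), GaugeField.gaugeAct s V = V →
      s = (fun _ => 1) ∨ s = (fun _ => (⟨-1, neg_one_mem⟩ : Matrix.specialUnitaryGroup (Fin 2) ℂ)) := by
  intro s hs
  -- `s • V = V` is the intertwiner relation, bond by bond
  have hcomm : ∀ b : PBond (F.P n) 0,
      ((s b.src : Matrix.specialUnitaryGroup (Fin 2) ℂ) : Matrix (Fin 2) (Fin 2) ℂ) * (V b : Matrix (Fin 2) (Fin 2) ℂ) =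
        (V b : Matrix (Fin 2) (Fin 2) ℂ) * ((s b.tgt : Matrix.specialUnitaryGroup (Fin 2) ℂ) : Matrix (Fin 2) (Fin 2) ℂ) := by
    intro b
    have hb : s b.src * V b * (s b.tgt)⁻¹ = V b := by
      have := congrArg (fun W : GaugeField (F.P n) 0 (Matrix.specialUnitaryGroup (Fin 2) ℂ) => W b) hs
      exact this
    have hb' : s b.src * V b = V b * s b.tgt := by
      calc s b.src * V b = s b.src * V b * (s b.tgt)⁻¹ * s b.tgt := by rw [inv_mul_cancel_right]
        _ = V b * s b.tgt := by rw [hb]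
    have := congrArg (fun g : Matrix.specialUnitaryGroup (Fin 2) ℂ => (g : Matrix (Fin 2) (Fin 2) ℂ)) hb'
    simpa only [Submonoid.coe_mul] using this
  obtain ⟨c, hc⟩ := hirr (fun x => ((s x : Matrix.specialUnitaryGroup (Fin 2) ℂ) : Matrix (Fin 2) (Fin 2) ℂ)) hcomm
  -- `det ↑(s x₀) = 1` forces `c² = 1`
  obtain ⟨x₀⟩ : Nonempty (Site (F.P n) 0) := ⟨default⟩
  have hdet : (c • (1 : Matrix (Fin 2) (Fin 2) ℂ)).det = 1 := by
    rw [← hc x₀]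
    exact (s x₀).prop.2
  have hc2 : c * c = 1 := by
    have h := hdet
    rw [Matrix.det_smul, Matrix.det_one, mul_one, Fintype.card_fin] at h
    simpa only [pow_two] using h
  rcases mul_self_eq_one_iff.mp hc2 with h1 | h1
  · left
    funext x
    apply Subtype.ext
    have hx := hc x
    rw [h1, one_smul] at hx
    exact hx
  · right
    funext x
    apply Subtype.ext
    have hx := hc x
    rw [h1, neg_smul, one_smul] at hx
    exact hx

end Irr

/-! ## §2 Prop. 7 clause 1 at every irreducible datum, `L ≥ 5` -/

/-- ★★ **[Balaban1985Variational] PROP. 7, CLAUSE 1, AT EVERY IRREDUCIBLE DATUM** (`L ≥ 5`, `0 < e ≤ e₈(L)`): over a datum `V` whose commutant is scalar (IRR(V),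
(T7b)'s binder) the variational problem (5), (6) has at most one critical orbit of print's group (4) — ✓pen 4 `atMostOneCriticalOrbit_of_centralStab_five` ∘ §1; zero further
hypotheses. [cite: Balaban1985Variational, Prop. 7 p.299] -/
theorem atMostOneCriticalOrbit_of_irr_five (L : ℕ) (h5 : 5 ≤ L) :
    ∃ e₈ : ℝ, 0 < e₈ ∧
      ∀ (F : T3Family), F.L = L → ∀ (n K : ℕ) (hnK : n < K) (e : ℝ) (V : GaugeField (F.P n) 0 (Matrix.specialUnitaryGroup (Fin 2) ℂ)),
        0 < e → e ≤ e₈ →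
        (∀ s : Site (F.P n) 0 → Matrix (Fin 2) (Fin 2) ℂ,
          (∀ b : PBond (F.P n) 0, s b.src * (V b : Matrix (Fin 2) (Fin 2) ℂ) = (V b : Matrix (Fin 2) (Fin 2) ℂ) * s b.tgt) →
            ∃ c : ℂ, ∀ x, s x = c • (1 : Matrix (Fin 2) (Fin 2) ℂ)) →
          (varProblem3 F n K hnK.le).AtMostOneCriticalOrbit e V := by
  obtain ⟨e₈, he₈, H⟩ := atMostOneCriticalOrbit_of_centralStab_five L h5
  exact ⟨e₈, he₈, fun F hF n K hnK e V he heε hirr => H F hF n K hnK e V he heε (centralStab_of_irr F V hirr)⟩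

/-! ## §3 Critical configurations over an irreducible datum are RESIDUALLY related -/

/-- ★ **OVER AN IRREDUCIBLE DATUM, TWO R2-CRITICAL (6)-REGULAR CONFIGURATIONS DIFFER BY A FINE GAUGE TRANSFORMATION WHOSE (1.29)-DESCENT IS IDENTICALLY `1`**
(`L ≥ 5`, `0 < e ≤ e₈(L)`): ✓pen 4 `critical_gaugeRelated_five` gives `U′ = u • U` with `(u↓) • V = V`; §1 makes `u↓ ≡ 1` or `u↓ ≡ −1`, and in the second case `(−1)·u`
has the same action (✓`gaugeAct_negOne_mul`) and descent `(−1)·(u↓) ≡ 1` (✓`descTransf_const_mul`). [cite: Balaban1985Variational, Prop. 7 p.299; Balaban1985RegularSpaces, (1.29) p.81] -/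
theorem critical_residualRelated_of_irr_five (L : ℕ) (h5 : 5 ≤ L) :
    ∃ e₈ : ℝ, 0 < e₈ ∧
      ∀ (F : T3Family), F.L = L → ∀ (n K : ℕ) (hnK : n < K) (e : ℝ) (V : GaugeField (F.P n) 0 (Matrix.specialUnitaryGroup (Fin 2) ℂ))
        (U U' : GaugeField (F.P K) 0 (Matrix.specialUnitaryGroup (Fin 2) ℂ)),
        0 < e → e ≤ e₈ →
        (∀ s : Site (F.P n) 0 → Matrix (Fin 2) (Fin 2) ℂ,
          (∀ b : PBond (F.P n) 0, s b.src * (V b : Matrix (Fin 2) (Fin 2) ℂ) = (V b : Matrix (Fin 2) (Fin 2) ℂ) * s b.tgt) →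
            ∃ c : ℂ, ∀ x, s x = c • (1 : Matrix (Fin 2) (Fin 2) ℂ)) →
        U ∈ regFibrePr F n K hnK.le e V → IsCritR2 F n K hnK.le V U → U' ∈ regFibrePr F n K hnK.le e V → IsCritR2 F n K hnK.le V U' →
          ∃ u : GaugeTransf (F.P K) 0 (Matrix.specialUnitaryGroup (Fin 2) ℂ),
            U' = GaugeField.gaugeAct u U ∧ descTransf F n K hnK.le u = fun _ => 1 := by
  obtain ⟨e₈, he₈, H⟩ := critical_gaugeRelated_five L h5
  refine ⟨e₈, he₈, ?_⟩
  intro F hF n K hnK e V U U' he heε hirr hU hcU hU' hcU'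
  obtain ⟨u, hrel, hfix⟩ := H F hF n K hnK e V U U' he heε hU hcU hU' hcU'
  rcases centralStab_of_irr F V hirr (descTransf F n K hnK.le u) hfix with h1 | h1
  · exact ⟨u, hrel, h1⟩
  · refine ⟨fun x => (⟨-1, neg_one_mem⟩ : Matrix.specialUnitaryGroup (Fin 2) ℂ) * u x, ?_, ?_⟩
    · rw [gaugeAct_negOne_mul]; exact hrel
    · rw [descTransf_const_mul, h1]
      funext y
      exact negOne_mul_negOne

end Summit.QuantumFields.YangMills.Theorems.FluctuationComparisonRegPrIntLS2BetaCentralStabOfIrr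

end
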